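import Mathlib.Analysis.Complex.Polynomial.Basic
import Literature.NumberTheory.LFunctions.WeilConjecturesFunctionalEquationProofs
import Literature.AlgebraicGeometry.Motives.EllAdicWeilCohomology
import HarnessLib

/-!
# Grothendieck's functional equation of `Z(X, T)`: reduction to `ℓ`-adic cohomology, and the
cases of dimension `≤ 1` from a Weil factorisation alone

The named fact `Literature.NumberTheory.LFunctions.hasFunctionalEquation_zetaSeries`
(`WeilConjectures.lean`; Grothendieck, Sém. Bourbaki 279, §5; Deligne, *Weil I*, (2.6);
Hartshorne, App. C, Thm. 1.2 / Thm. 4.4) says: for `X` smooth projective of dimension `n` over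
the finite field `k` (`q = #k`) and every Weil factorisation `(Pᵢ)` of `Z(X, T)`,
`Z(1/(qⁿT)) = ± q^{nχ/2} T^χ Z(T)` with `χ = ∑ (-1)ⁱ deg Pᵢ`
(`Literature.AlgebraicGeometry.Motives.HasFunctionalEquation`). This file adds two complements
to the cohomological proof in `WeilConjecturesFunctionalEquationProofs.lean`.

1. **The reduction, closed up.** That file proves the fact from *any* Weil cohomology theory
   with Galois action satisfying the Lefschetz trace formula and `χ(φ) = q`
   (`hasFunctionalEquation_zetaSeries_of_galoisWeilCohomology`); the existence of such a
   theory (`ℓ`-adic étale cohomology, `ℓ ∤ q`) is the named fact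
   `Literature.AlgebraicGeometry.Motives.exists_galoisWeilCohomology_hasLefschetzTraceFormula`
   (`EllAdicWeilCohomology.lean`, where `χ_ℓ(φ) = q` is proved).
   `hasFunctionalEquation_zetaSeries_of_exists_galoisWeilCohomology` assembles the two: the
   fact is a consequence of that single existence statement, so that discharging it outright
   amounts to constructing `ℓ`-adic cohomology with Poincaré duality and the trace formula
   (SGA 4, 4½, 5), which neither Mathlib nor the Literature tree has.
2. **Dimension `≤ 1` needs no cohomology.** The algebraic half of the cohomological proof
   (`WeilFunctionalEquation.hasFunctionalEquation_of_map`; Hartshorne, App. C, Thm. 4.4; Kahn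
   2020, (3.6.5)–(3.6.6)) derives the functional equation from the *self-duality*
   `A^rev(qⁿT) = a·A`, `B^rev(qⁿT) = b·B` of `A = ∏_{i odd} Pᵢ` and `B = ∏_{i even} Pᵢ`,
   which in general is Poincaré duality (`Pᵢ ↔ P₂ₙ₋ᵢ`, `α ↦ qⁿ/α`). For `n ≤ 1` it follows
   from the clauses of `Literature.AlgebraicGeometry.Motives.IsWeilFactorization` alone:
   `P₀ = 1 - T ↔ P₂ₙ = 1 - qⁿT` are exchanged by `T ↦ 1/(qⁿT)`, and for `n = 1` the middle
   polynomial `P₁ ∈ ℤ[T]` is self-dual because the Riemann hypothesis `|α| = q^{1/2}` and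
   reality of the coefficients pair each reciprocal root `α` with `ᾱ = q/α` (the verification
   asked for in Hartshorne, App. C, Ex. 5.6 for elliptic curves, "`f f̂ = q`"; cf. Ex. 5.7
   (c)). We prove the assembly `hasFunctionalEquation_of_isWeilFactorization_of_reverse_comp_eq`
   for any `n` (Weil factorisation + self-duality of the odd and even products over `ℂ` ⟹
   functional equation), the self-duality lemma `exists_reverse_comp_eq_C_mul_of_norm_roots`
   (a conjugation-invariant complex polynomial with all roots on the circle `|z|² c = 1`
   satisfies `P^rev(cT) = a·P(T)`), and deduce the cases `n = 0`, `n = 1` of the functional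
   equation for *every* `Z ∈ ℚ⟦T⟧` with a Weil factorisation
   (`hasFunctionalEquation_of_isWeilFactorization_zero`, `…_one`), hence for `Z(X, T)` of any
   `k`-scheme with such a factorisation: the instances `n = 0, 1` of the named fact, its
   smoothness hypothesis being unused. For `n ≥ 2` there is no such shortcut:
   `Z = (1 + q³T²)/((1 - T)(1 - q²T))` satisfies every clause of `IsWeilFactorization q 2 Z P`
   (`P₁ = P₂ = 1`, `P₃ = 1 + q³T²`) but `Z(1/(q²T))/Z(T) = q(1 + qT²)/(1 + q³T²)` is not a
   monomial, so for surfaces and beyond the duality `Pᵢ ↔ P₂ₙ₋ᵢ` is genuine geometric input.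

## References

* A. Grothendieck, *Formule de Lefschetz et rationalité des fonctions L*, Sém. Bourbaki 279
  (1964/65), §5. [Grothendieck1965]
* P. Deligne, *La conjecture de Weil. I*, Publ. Math. IHÉS 43 (1974), (2.6), p. 281.
  [Deligne1974]
* R. Hartshorne, *Algebraic Geometry* (1977), App. C, Thm. 1.2, (1.3)–(1.4), Lemma 4.3,
  Thm. 4.4, Ex. 5.6, 5.7. [Hartshorne1977]
* B. Kahn, *Zeta and L-functions of varieties and motives* (2020), Thm. 3.65, (3.6.4)–(3.6.6).
  [Kahn2020]

## Design notes

No definitions; helpers live in `namespace …LFunctions.WeilFunctionalEquation` next to those of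
the cohomological proof, whose `hasFunctionalEquation_of_map` (`K = ℂ`) does all the work once
self-duality is known. Schemes are called `Y` (`X` is the polynomial variable). The fundamental
theorem of algebra (`Mathlib.Analysis.Complex.Polynomial.Basic`) splits `P₁` over `ℂ`.
-/

universe u

open Polynomial

noncomputable section

namespace Literature.NumberTheory.LFunctions

/-! ### The reduction of the named fact to the existence of `ℓ`-adic cohomology -/

section Reduction

variable {k : Type u} [Field k] [Finite k]

/-- **Grothendieck's functional equation, granted `ℓ`-adic cohomology** (Grothendieck, Sém.
Bourbaki 279 (1964/65), §5; Deligne, *Weil I* (1974), (2.6); Hartshorne, App. C, Thm. 4.4; Kahn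
2020, Thm. 3.65). The named fact
`Literature.NumberTheory.LFunctions.hasFunctionalEquation_zetaSeries` over the finite field `k`
follows from the single named fact
`Literature.AlgebraicGeometry.Motives.exists_galoisWeilCohomology_hasLefschetzTraceFormula k`
(existence, for primes `ℓ` invertible in `k`, of `ℓ`-adic cohomology as a Weil cohomology theory
with Galois action satisfying the Lefschetz trace formula): pick any such `ℓ`
(`exists_galoisWeilCohomology_hasLefschetzTraceFormula.exists_prime`, which also supplies
`χ_ℓ(φ) = q`) and apply the cohomological proof
`hasFunctionalEquation_zetaSeries_of_galoisWeilCohomology`. This is the complete dependency of the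
fact on unproved inputs. [cite: Deligne1974, (2.6)] -/
theorem hasFunctionalEquation_zetaSeries_of_exists_galoisWeilCohomology
    (h : Literature.AlgebraicGeometry.Motives.exists_galoisWeilCohomology_hasLefschetzTraceFormula
      k) : hasFunctionalEquation_zetaSeries (k := k) := by
  obtain ⟨ℓ, _, E, hE, hχ⟩ := h.exists_prime
  exact hasFunctionalEquation_zetaSeries_of_galoisWeilCohomology E hE hχ

end Reduction

namespace WeilFunctionalEquation

/-! ### Self-duality of a polynomial whose roots are permuted by `z ↦ 1/(cz)` -/

section SelfDual

variable {K : Type*} [Field K]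

/-- `(T - z)^rev = 1 - zT` (`Polynomial.reverse` of a monic linear polynomial). [folklore] -/
theorem reverse_X_sub_C_eq (z : K) : (X - C z).reverse = 1 - C z * X := by
  rw [reverse, natDegree_X_sub_C, reflect_sub, reflect_one_X, reflect_C, pow_one]

/-- `(1 - wT)^rev = T - w` for `w ≠ 0`. [folklore] -/
theorem reverse_one_sub_C_mul_X {w : K} (hw : w ≠ 0) : (1 - C w * X : K[X]).reverse = X - C w := by
  have hd : (1 - C w * X : K[X]).natDegree = 1 := by
    rw [natDegree_sub_eq_right_of_natDegree_lt] <;> rw [natDegree_C_mul_X w hw]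
    simp
  rw [reverse, hd, reflect_sub, reflect_one, reflect_C_mul, reflect_one_X, pow_one, mul_one]

/-- `(1 - T)^rev = T - 1`. [folklore] -/
theorem reverse_one_sub_X : (1 - X : K[X]).reverse = X - 1 := by
  simpa using reverse_one_sub_C_mul_X (one_ne_zero (α := K))

/-- Over a field, `Polynomial.reverse` is multiplicative on multiset products
(`Polynomial.reverse_mul_of_domain`). [folklore] -/
theorem reverse_multiset_prod (s : Multiset K[X]) : s.prod.reverse = (s.map reverse).prod := by
  induction s using Multiset.induction_on with
  | empty => rw [Multiset.prod_zero, Multiset.map_zero, Multiset.prod_zero, ← C_1, reverse_C]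
  | cons a s ih =>
    rw [Multiset.prod_cons, Multiset.map_cons, Multiset.prod_cons, reverse_mul_of_domain, ih]

/-- `1 - wT = (-w) · (T - w⁻¹)` for `w ≠ 0`. [folklore] -/
theorem one_sub_C_mul_X_eq {w : K} (hw : w ≠ 0) :
    (1 - C w * X : K[X]) = C (-w) * (X - C w⁻¹) := by
  rw [mul_sub, ← C_mul, neg_mul, mul_inv_cancel₀ hw]
  simp only [map_neg, map_one]
  ring

/-- **Self-duality from a symmetry of the roots.** Let `P` be a split polynomial over a field with
non-zero roots `z₁, …, z_d` (with multiplicity) and `c ≠ 0` such that the multiset of roots is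
stable under `z ↦ 1/(cz)`. Then `P^rev(cT) = a · P(T)` with `a = ∏ⱼ (-c zⱼ)`
(`P^rev = Polynomial.reverse P`, `T^d P(1/T)`): `P^rev(cT) = lead(P) ∏ⱼ (1 - c zⱼ T)
= lead(P) ∏ⱼ (-c zⱼ)(T - 1/(c zⱼ))` and the `1/(c zⱼ)` are again the roots — the duality
`α ↦ qⁿ/α` of reciprocal roots (Hartshorne, App. C, proof of Thm. 4.4), as algebra. [folklore] -/
theorem exists_reverse_comp_C_mul_X_eq_C_mul {P : K[X]} (hs : P.Splits) {c : K} (hc : c ≠ 0)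
    (h0 : ∀ z ∈ P.roots, z ≠ 0) (hinv : P.roots.map (fun z => (c * z)⁻¹) = P.roots) :
    ∃ a : K, P.reverse.comp (C c * X) = C a * P := by
  refine ⟨(P.roots.map fun z => -(c * z)).prod, ?_⟩
  have hP := hs.eq_prod_roots
  have h1 : P.reverse = C P.leadingCoeff * (P.roots.map fun z => 1 - C z * X).prod := by
    conv_lhs => rw [hP]
    rw [reverse_mul_of_domain, reverse_C, reverse_multiset_prod, Multiset.map_map]
    congr 2
    exact Multiset.map_congr rfl fun z _ => reverse_X_sub_C_eq z
  have h2 : (P.roots.map fun z => 1 - C z * X).prod.comp (C c * X) =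
      (P.roots.map fun z => C (-(c * z)) * (X - C (c * z)⁻¹)).prod := by
    rw [multiset_prod_comp, Multiset.map_map]
    refine congr_arg _ (Multiset.map_congr rfl fun z hz => ?_)
    simp only [Function.comp_apply, sub_comp, one_comp, mul_comp, C_comp, X_comp]
    rw [← mul_assoc, ← C_mul, mul_comm z c]
    exact one_sub_C_mul_X_eq (mul_ne_zero hc (h0 z hz))
  have e2 : (P.roots.map fun z => X - C (c * z)⁻¹) =
      (P.roots.map fun z => (c * z)⁻¹).map (X - C ·) := by rw [Multiset.map_map]; rfl
  have h3 : (P.roots.map fun z => C (-(c * z)) * (X - C (c * z)⁻¹)).prod =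
      C (P.roots.map fun z => -(c * z)).prod * (P.roots.map (X - C ·)).prod := by
    rw [Multiset.prod_map_mul, e2, hinv, map_multiset_prod C, Multiset.map_map]
    rfl
  rw [h1, mul_comp, C_comp, h2, h3]
  calc C P.leadingCoeff * (C (P.roots.map fun z => -(c * z)).prod * (P.roots.map (X - C ·)).prod)
      = C (P.roots.map fun z => -(c * z)).prod *
          (C P.leadingCoeff * (P.roots.map (X - C ·)).prod) := by ring
    _ = _ := by rw [← hP]

/-- **Self-duality from the Riemann hypothesis and real coefficients.** Let `P ∈ ℂ[T]` be invariant
under complex conjugation of its coefficients (e.g. `P ∈ ℤ[T]`) and `c > 0` such that every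
complex root `z` of `P` has `|z|² c = 1` (for `Pᵢ(X, T)` of a Weil factorisation: `|z| = q^{-i/2}`,
`c = qⁱ`). Then `P^rev(cT) = a · P(T)` for some `a ∈ ℂ`: conjugation permutes the roots (the
polynomial splits over `ℂ`) and `z̄ = 1/(cz)` on the circle. For `i = n = 1` this is the pairing
`α ↦ q/α = ᾱ` of the reciprocal roots of `P₁` (Hartshorne, App. C, Ex. 5.6, 5.7 (c)). [folklore] -/
theorem exists_reverse_comp_eq_C_mul_of_norm_roots {P : ℂ[X]} (hconj : P.map (starRingEnd ℂ) = P)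
    {c : ℝ} (hc : 0 < c) (h : ∀ z : ℂ, P.IsRoot z → ‖z‖ ^ 2 * c = 1) :
    ∃ a : ℂ, P.reverse.comp (C (c : ℂ) * X) = C a * P := by
  by_cases hP : P = 0
  · exact ⟨0, by simp [hP]⟩
  have hs : P.Splits := IsAlgClosed.splits P
  have hcC : (c : ℂ) ≠ 0 := Complex.ofReal_ne_zero.mpr hc.ne'
  have hroot : ∀ z ∈ P.roots, z ≠ 0 ∧ (starRingEnd ℂ) z = ((c : ℂ) * z)⁻¹ := by
    intro z hz
    have hz' := h z ((mem_roots hP).mp hz)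
    have hz0 : z ≠ 0 := by
      rintro rfl
      rw [norm_zero, zero_pow two_ne_zero, zero_mul] at hz'
      exact zero_ne_one hz'
    refine ⟨hz0, ?_⟩
    have hmul : z * (starRingEnd ℂ) z = (c : ℂ)⁻¹ := by
      rw [Complex.mul_conj, Complex.normSq_eq_norm_sq, show ‖z‖ ^ 2 = c⁻¹ from
        eq_inv_of_mul_eq_one_left hz', Complex.ofReal_inv]
    rw [mul_inv, ← hmul, mul_comm z, mul_assoc, mul_inv_cancel₀ hz0, mul_one]
  refine exists_reverse_comp_C_mul_X_eq_C_mul hs hcC (fun z hz => (hroot z hz).1) ?_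
  calc P.roots.map (fun z => ((c : ℂ) * z)⁻¹) = P.roots.map (starRingEnd ℂ) :=
        Multiset.map_congr rfl fun z hz => ((hroot z hz).2).symm
    _ = (P.map (starRingEnd ℂ)).roots := (hs.roots_map_of_injective (starRingEnd ℂ).injective).symm
    _ = P.roots := by rw [hconj]

end SelfDual

/-! ### The functional equation from a Weil factorisation with self-dual products -/

section Assembly

open Literature.AlgebraicGeometry.Motives

/-- **The functional equation from a self-dual Weil factorisation** (the algebra of Hartshorne,
App. C, Thm. 4.4 / Kahn 2020, (3.6.5)–(3.6.6), with the cohomological input replaced by a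
hypothesis). Let `Z ∈ ℚ⟦T⟧` have a Weil factorisation `(Pᵢ)_{0 ≤ i ≤ 2n}` for `q > 0`
(`IsWeilFactorization q n Z P`; only `Pᵢ(0) = 1` and `Z · ∏_{even} Pᵢ = ∏_{odd} Pᵢ` are used)
whose numerator `A = ∏_{i odd} Pᵢ` and denominator `B = ∏_{i even} Pᵢ` are, over `ℂ`, self-dual
for `T ↦ 1/(qⁿT)`: `A^rev(qⁿT) = a · A(T)`, `B^rev(qⁿT) = b · B(T)`. Then
`Z(1/(qⁿT)) = ± q^{nχ/2} T^χ Z(T)`, `χ = ∑ (-1)ⁱ deg Pᵢ` (`HasFunctionalEquation q n Z χ`):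
`χ = deg B - deg A`, then `hasFunctionalEquation_of_map` with `K = ℂ`. For `Z(X, T)` the
self-duality is Poincaré duality (`reverse_prod_frobCharPoly_comp`); for `n ≤ 1` it is automatic
(below). [cite: Hartshorne1977, App. C Thm. 4.4] -/
theorem hasFunctionalEquation_of_isWeilFactorization_of_reverse_comp_eq {q n : ℕ} (hq : 0 < q)
    {Z : PowerSeries ℚ} {P : Fin (2 * n + 1) → ℤ[X]} (hP : IsWeilFactorization q n Z P) {a b : ℂ}
    (ha : (∏ i ∈ (Finset.univ : Finset (Fin (2 * n + 1))) with Odd i.val,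
        (P i).map (Int.castRingHom ℂ)).reverse.comp (C ((q : ℂ) ^ n) * X) =
      C a * ∏ i ∈ (Finset.univ : Finset (Fin (2 * n + 1))) with Odd i.val,
        (P i).map (Int.castRingHom ℂ))
    (hb : (∏ i ∈ (Finset.univ : Finset (Fin (2 * n + 1))) with Even i.val,
        (P i).map (Int.castRingHom ℂ)).reverse.comp (C ((q : ℂ) ^ n) * X) =
      C b * ∏ i ∈ (Finset.univ : Finset (Fin (2 * n + 1))) with Even i.val,
        (P i).map (Int.castRingHom ℂ)) :
    HasFunctionalEquation q n Z
      (∑ i : Fin (2 * n + 1), (-1 : ℤ) ^ (i : ℕ) * ((P i).natDegree : ℤ)) := by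
  classical
  obtain ⟨hP0, hZ, -, -, -⟩ := hP
  -- the rational presentation `Z · B = A`
  set A : ℚ[X] := ∏ i ∈ (Finset.univ : Finset (Fin (2 * n + 1))) with Odd i.val,
    (P i).map (Int.castRingHom ℚ) with hA
  set B : ℚ[X] := ∏ i ∈ (Finset.univ : Finset (Fin (2 * n + 1))) with Even i.val,
    (P i).map (Int.castRingHom ℚ) with hB
  have hZ' : Z * (B : PowerSeries ℚ) = A := by
    rw [hA, hB, coe_prod, coe_prod]
    exact hZ
  have hPi : ∀ i, (P i).map (Int.castRingHom ℚ) ≠ 0 := fun i h => by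
    have := congrArg (fun p : ℚ[X] => p.coeff 0) h
    simp [Polynomial.coeff_map, hP0 i] at this
  have h0 : ∀ (p : Fin (2 * n + 1) → Prop) [DecidablePred p],
      (∏ i ∈ (Finset.univ : Finset (Fin (2 * n + 1))) with p i,
        (P i).map (Int.castRingHom ℚ)).coeff 0 = 1 := by
    intro p _
    rw [coeff_zero_prod]
    exact Finset.prod_eq_one fun i _ => by rw [Polynomial.coeff_map, hP0 i, map_one]
  have hA0 : A.coeff 0 ≠ 0 := by rw [hA, h0]; exact one_ne_zero
  have hB0 : B.coeff 0 ≠ 0 := by rw [hB, h0]; exact one_ne_zero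
  -- the Euler characteristic `χ = deg B - deg A`
  have hχ' : (∑ i : Fin (2 * n + 1), (-1 : ℤ) ^ (i : ℕ) * ((P i).natDegree : ℤ)) =
      (B.natDegree : ℤ) - A.natDegree := by
    rw [hA, hB, natDegree_prod _ _ fun i _ => hPi i, natDegree_prod _ _ fun i _ => hPi i,
      ← Finset.sum_filter_add_sum_filter_not Finset.univ (fun i : Fin (2 * n + 1) => Even i.val),
      Nat.cast_sum, Nat.cast_sum]
    simp only [natDegree_map_eq_of_injective (Int.castRingHom ℚ).injective_int]
    rw [Finset.sum_congr rfl fun i hi => by rw [(Finset.mem_filter.mp hi).2.neg_one_pow, one_mul],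
      Finset.sum_congr (Finset.filter_congr fun i _ => Nat.not_even_iff_odd) fun i hi => by
        rw [(Finset.mem_filter.mp hi).2.neg_one_pow, neg_one_mul],
      Finset.sum_neg_distrib]
    ring
  rw [hχ']
  -- the same presentation over `ℂ`
  have hf : (algebraMap ℚ ℂ).comp (Int.castRingHom ℚ) = Int.castRingHom ℂ := RingHom.ext_int _ _
  have hmap : ∀ (p : Fin (2 * n + 1) → Prop) [DecidablePred p],
      (∏ i ∈ (Finset.univ : Finset (Fin (2 * n + 1))) with p i,
        (P i).map (Int.castRingHom ℚ)).map (algebraMap ℚ ℂ) =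
      ∏ i ∈ (Finset.univ : Finset (Fin (2 * n + 1))) with p i, (P i).map (Int.castRingHom ℂ) := by
    intro p _
    rw [Polynomial.map_prod]
    exact Finset.prod_congr rfl fun i _ => by rw [Polynomial.map_map, hf]
  have hZK : Z.map (algebraMap ℚ ℂ) * ((B.map (algebraMap ℚ ℂ) : ℂ[X]) : PowerSeries ℂ) =
      (A.map (algebraMap ℚ ℂ) : ℂ[X]) := by
    rw [Polynomial.polynomial_map_coe, Polynomial.polynomial_map_coe, ← map_mul, hZ']
  have hA'0 : (A.map (algebraMap ℚ ℂ)).coeff 0 ≠ 0 := by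
    rw [coeff_map]; exact (_root_.map_ne_zero _).mpr hA0
  have hB'0 : (B.map (algebraMap ℚ ℂ)).coeff 0 ≠ 0 := by
    rw [coeff_map]; exact (_root_.map_ne_zero _).mpr hB0
  rw [← hmap] at ha hb
  exact hasFunctionalEquation_of_map hq hB0 hZ' hA'0 hB'0 hZK ha hb

end Assembly

end WeilFunctionalEquation

/-! ### Dimension `0` and dimension `1` -/

section LowDimension

open Literature.AlgebraicGeometry.Motives WeilFunctionalEquation

/-- **The functional equation in dimension `0`** (Hartshorne, App. C, (1.2) with `n = 0`; the zeta
function of a point, `Z(Spec 𝔽_q, T) = 1/(1 - T)`, Ex. 5.2 with `n = 0`). A Weil factorisation in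
dimension `0` consists of `P₀ = 1 - T` alone, `Z = 1/(1 - T)`, and `Z(1/T) = -T · Z(T)`:
`HasFunctionalEquation q 0 Z χ` with `χ = deg P₀ = 1` (`(1 - T)^rev = T - 1 = -(1 - T)`; the empty
numerator is trivially self-dual). [folklore] -/
theorem hasFunctionalEquation_of_isWeilFactorization_zero {q : ℕ} (hq : 0 < q) {Z : PowerSeries ℚ}
    {P : Fin (2 * 0 + 1) → ℤ[X]} (hP : IsWeilFactorization q 0 Z P) :
    HasFunctionalEquation q 0 Z
      (∑ i : Fin (2 * 0 + 1), (-1 : ℤ) ^ (i : ℕ) * ((P i).natDegree : ℤ)) := by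
  have heven : (Finset.univ : Finset (Fin (2 * 0 + 1))).filter (fun i => Even i.val) = {0} := by
    decide
  have hodd : (Finset.univ : Finset (Fin (2 * 0 + 1))).filter (fun i => Odd i.val) = ∅ := by
    decide
  obtain ⟨-, -, hP₀, -, -⟩ := id hP
  refine hasFunctionalEquation_of_isWeilFactorization_of_reverse_comp_eq hq hP (a := 1) (b := -1)
    ?_ ?_
  · rw [hodd, Finset.prod_empty, show (1 : ℂ[X]) = C 1 from C_1.symm, reverse_C, C_comp, ← C_mul,
      mul_one]
  · rw [heven, Finset.prod_singleton, hP₀, Polynomial.map_sub, Polynomial.map_one, map_X,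
      reverse_one_sub_X, pow_zero, C_1, one_mul, sub_comp, X_comp, one_comp]
    simp only [map_neg, map_one]
    ring

/-- **The functional equation for a Weil factorisation in dimension `1`** (curves; Hartshorne,
App. C, Thm. 1.2 for `n = 1`, and Ex. 5.6 ("verify the functional equation"), Ex. 5.7 (c)). If
`Z ∈ ℚ⟦T⟧` has a Weil factorisation `Z = P₁(T)/((1 - T)(1 - qT))`, `P₁ ∈ ℤ[T]`, `P₁(0) = 1`, all
complex reciprocal roots of `P₁` of absolute value `q^{1/2}`, then
`Z(1/(qT)) = ± q^{χ/2} T^χ Z(T)` with `χ = 2 - deg P₁` (`HasFunctionalEquation q 1 Z χ`,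
`χ = deg P₀ - deg P₁ + deg P₂`). No geometry is used: `((1 - T)(1 - qT))^rev(qT) = (qT - 1)(qT - q)
= q (1 - T)(1 - qT)` directly, and `P₁` is self-dual by the Riemann hypothesis and reality
(`exists_reverse_comp_eq_C_mul_of_norm_roots`, `ᾱ = q/α`). (For an actual curve the functional
equation classically comes from Riemann–Roch, F. K. Schmidt 1931, before RH.) [folklore] -/
theorem hasFunctionalEquation_of_isWeilFactorization_one {q : ℕ} (hq : 0 < q) {Z : PowerSeries ℚ}
    {P : Fin (2 * 1 + 1) → ℤ[X]} (hP : IsWeilFactorization q 1 Z P) :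
    HasFunctionalEquation q 1 Z
      (∑ i : Fin (2 * 1 + 1), (-1 : ℤ) ^ (i : ℕ) * ((P i).natDegree : ℤ)) := by
  have heven : (Finset.univ : Finset (Fin (2 * 1 + 1))).filter (fun i => Even i.val) = {0, 2} := by
    decide
  have hodd : (Finset.univ : Finset (Fin (2 * 1 + 1))).filter (fun i => Odd i.val) = {1} := by
    decide
  obtain ⟨-, -, hP₀, hP₂, hRH⟩ := id hP
  have hq0 : (0 : ℝ) < q := Nat.cast_pos.mpr hq
  have hqC : (q : ℂ) ≠ 0 := Nat.cast_ne_zero.mpr hq.ne'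
  -- the numerator `P₁` is self-dual: Riemann hypothesis and reality
  have hconj : ((P 1).map (Int.castRingHom ℂ)).map (starRingEnd ℂ) =
      (P 1).map (Int.castRingHom ℂ) := by
    rw [Polynomial.map_map, RingHom.ext_int ((starRingEnd ℂ).comp _) (Int.castRingHom ℂ)]
  obtain ⟨a, ha⟩ := exists_reverse_comp_eq_C_mul_of_norm_roots hconj hq0 fun z hz => by
    have h := hRH 1 z hz
    rw [show ((1 : Fin (2 * 1 + 1)) : ℕ) = 1 from rfl, Nat.cast_one] at h
    rw [h, ← Real.rpow_natCast, ← Real.rpow_mul hq0.le,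
      show -(1 : ℝ) / 2 * ((2 : ℕ) : ℝ) = -1 by norm_num, Real.rpow_neg_one,
      inv_mul_cancel₀ hq0.ne']
  rw [Complex.ofReal_natCast] at ha
  -- the denominator `(1 - T)(1 - qT)` is self-dual: direct computation
  have hb : ((1 - X) * (1 - C (q : ℂ) * X) : ℂ[X]).reverse.comp (C ((q : ℂ) ^ 1) * X) =
      C (q : ℂ) * ((1 - X) * (1 - C (q : ℂ) * X)) := by
    rw [reverse_mul_of_domain, reverse_one_sub_X, reverse_one_sub_C_mul_X hqC, pow_one]
    simp only [mul_comp, sub_comp, X_comp, C_comp, one_comp]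
    ring
  refine hasFunctionalEquation_of_isWeilFactorization_of_reverse_comp_eq hq hP (a := a) (b := q)
    ?_ ?_
  · rw [hodd, Finset.prod_singleton, pow_one]
    exact ha
  · rw [heven, Finset.prod_pair (by decide), hP₀,
      show (2 : Fin (2 * 1 + 1)) = Fin.last (2 * 1) from rfl, hP₂]
    simp only [Polynomial.map_sub, Polynomial.map_one, Polynomial.map_mul, Polynomial.map_X,
      Polynomial.map_natCast, map_natCast, pow_one] at hb ⊢
    exact hb

variable {k : Type u} [Field k] [Finite k]

/-- **Dimension `0` case of `hasFunctionalEquation_zetaSeries`, unconditionally**: for a `k`-scheme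
`Y` whose zeta function has a Weil factorisation in dimension `0` (`Z(Y, T) = 1/(1 - T)`, e.g.
`Y = Spec k`), `Z(Y, 1/T) = ± T Z(Y, T)` (Hartshorne, App. C, (1.2), `n = 0`) — the instance
`n = 0` of the named fact, its smoothness hypothesis being unused. [folklore] -/
theorem hasFunctionalEquation_zetaSeries_of_isWeilFactorization_zero {Y : SchemeOver k}
    {P : Fin (2 * 0 + 1) → ℤ[X]} (hP : IsWeilFactorization (Nat.card k) 0 (zetaSeries Y) P) :
    HasFunctionalEquation (Nat.card k) 0 (zetaSeries Y)
      (∑ i : Fin (2 * 0 + 1), (-1 : ℤ) ^ (i : ℕ) * ((P i).natDegree : ℤ)) :=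
  hasFunctionalEquation_of_isWeilFactorization_zero Nat.card_pos hP

/-- **Curve case of `hasFunctionalEquation_zetaSeries`, unconditionally** (Hartshorne, App. C,
Thm. 1.2 with `n = 1`; Ex. 5.6, 5.7): for a `k`-scheme `Y` (`q = #k`) whose zeta function has a
Weil factorisation in dimension `1`, `Z(Y, T) = P₁(T)/((1 - T)(1 - qT))` with `P₁ ∈ ℤ[T]`
satisfying the Riemann hypothesis, `Z(Y, 1/(qT)) = ± q^{χ/2} T^χ Z(Y, T)`, `χ = 2 - deg P₁` —
the instance `n = 1` of the named fact, its smoothness hypothesis being unused: in dimension `1`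
the functional equation is a formal consequence of the Weil factorisation. [folklore] -/
theorem hasFunctionalEquation_zetaSeries_of_isWeilFactorization_one {Y : SchemeOver k}
    {P : Fin (2 * 1 + 1) → ℤ[X]} (hP : IsWeilFactorization (Nat.card k) 1 (zetaSeries Y) P) :
    HasFunctionalEquation (Nat.card k) 1 (zetaSeries Y)
      (∑ i : Fin (2 * 1 + 1), (-1 : ℤ) ^ (i : ℕ) * ((P i).natDegree : ℤ)) :=
  hasFunctionalEquation_of_isWeilFactorization_one Nat.card_pos hP

end LowDimension

end Literature.NumberTheory.LFunctions

end
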